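import Literature.Analysis.FluidPDE.PassiveVectorUniqueness
import Literature.Analysis.FluidPDE.PassiveScalarEnergyMollified
import HarnessLib

/-!
# Weak passive-vector solutions: the energy identity of one mode

Analysis/FluidPDE proof-support file (everything proved; no new definitions). First brick of the
vector Fourier–Galerkin energy argument for the weak class `Torus.IsWeakPassiveVectorOn A T ν b w₀ w`
(`∂ₜw + (b·∇)w + A (w·∇)b + ∇π = νΔw`, `∇·w = 0`; Yoshida–Kaneda 2000, (4)–(5)), the vector twin of
`PassiveScalarDiagGalerkin.ae_mode_energy_eq`:

* `IsWeakPassiveVectorOn.ae_mode_energy_eq` — for a smooth divergence-free steady field `G`,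
  `(∫⟪w(t), G⟫)² = (∫⟪w₀, G⟫)² + 2 ∫_{(0,t]} Φ_G(τ) (∫⟪w(τ), G⟫) dτ` for a.e. `t`, where
  `Φ_G = ∫⟪w, (b·∇)G + νΔG⟫ + A ∫⟪b, (w·∇)G⟫` (the Galerkin system tested against its own solution,
  Robinson–Rodrigo–Sadowski 2016 §4.2, one mode at a time);
* `IsWeakPassiveVectorOn.ae_sq_norm_inner_mFourierCoeff_eq` — the same in Fourier variables, for a
  frequency `k` and a transversal vector `z` (`k · z = 0`), with `α(t) = ⟪ŵ(t)(k), z⟫_ℂ`,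
  `νₖ = 4π²ν|k|²`, `β(τ) = ∑ⱼ 2πikⱼ ⟪𝓕(bⱼw)(τ)(k), z⟫ + A ∑ⱼ 2πikⱼ ⟪𝓕(wⱼb)(τ)(k), z⟫`:
  `|α(t)|² = |α(0)|² + 2 ∫_{(0,t]} (-νₖ |α(τ)|² + Re (conj α(τ) · β(τ))) dτ` for a.e. `t`
  (from the modewise integral identity `PassiveVectorFourier.ae_inner_mFourierCoeff_eq`, real and
  imaginary parts squared by the product rule for a.e. primitives).

Summed over the Leray frame `z⁽ⁱ⁾(k)` (`FunctionSpaces/TorusLerayFrame`) and over `|k| ≤ N` these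
give the truncated energy identity of the weak solution (LIT-PACK §40b of cell `ad-ideate`); the
a.e. bound `|α| ≤ ‖z‖ sup_t ‖w(t)‖₂` (`exists_ae_norm_inner_mFourierCoeff_le`) makes `conj α · β`
integrable.

## Mathlib / tree search

Tree: `PassiveVectorClass` (`ae_integral_inner_eq`), `PassiveVectorFourier`
(`ae_inner_mFourierCoeff_eq`, `integrableOn_modeRHS`), `PassiveScalarEnergyMollified`
(`sq_const_add_setIntegral_eq`), `PassiveScalarFourier` (`re_integral_eq`, `im_integral_eq`).
`lean search 'ae_mode_energy_eq'`: scalar only (`PassiveScalarDiagGalerkin`).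

## References

* J. C. Robinson, J. L. Rodrigo, W. Sadowski, *The three-dimensional Navier–Stokes equations*
  (CUP 2016), §4.2 (Galerkin energy estimate (4.20)), Ch. 2 Def. 2.8. [`RobinsonRodrigoSadowski2016`]
* K. Yoshida, Y. Kaneda, Phys. Rev. E 63 (2000) 016308, §II eq. (4)–(5). [`YoshidaKaneda2000`]
* R. J. DiPerna, P.-L. Lions, Invent. Math. 98 (1989), §II.1, (12)–(14). [`DiPernaLions1989`]
-/

noncomputable section

open MeasureTheory Set Filter Function TopologicalSpace Complex UnitAddTorus
open scoped ENNReal NNReal InnerProductSpace ComplexConjugate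

namespace Literature.Analysis.FluidPDE

namespace Torus

variable {d : Type*} [Fintype d]

/-! ## Scalar lemmas -/

section Scalar

/-- Product rule for an a.e. primitive with datum: `U(t) = c + ∫_{(0,t]} F` a.e. with `F ∈ L¹(0,T)`
gives `U(t)² = c² + 2 ∫_{(0,t]} F U` a.e. (twin of the private lemma of `PassiveScalarDiagGalerkin`).
[folklore] -/
private theorem ae_sq_eq_of_ae_eq_add_setIntegral' {T c : ℝ} {U F : ℝ → ℝ} (hF : IntegrableOn F (Ioo 0 T) volume)
    (hU : ∀ᵐ t ∂(volume.restrict (Ioo 0 T)), U t = c + ∫ τ in Ioc 0 t, F τ) :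
    ∀ᵐ t ∂(volume.restrict (Ioo 0 T)), U t ^ 2 = c ^ 2 + 2 * ∫ τ in Ioc 0 t, F τ * U τ := by
  have hU' : ∀ᵐ τ ∂(volume : Measure ℝ), τ ∈ Ioo 0 T → U τ = c + ∫ r in Ioc 0 τ, F r :=
    (ae_restrict_iff' measurableSet_Ioo).1 hU
  filter_upwards [hU, ae_restrict_mem measurableSet_Ioo] with t ht htT
  have hsub : Ioc 0 t ⊆ Ioo 0 T := Ioc_subset_Ioo_right htT.2
  rw [ht, sq_const_add_setIntegral_eq (hF.mono_set hsub)]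
  congr 1
  congr 1
  refine setIntegral_congr_ae measurableSet_Ioc ?_
  filter_upwards [hU'] with τ hτ hτI
  rw [hτ (hsub hτI)]

/-- `Re a · Re h + Im a · Im h = Re (conj a · h)`. [folklore] -/
private theorem re_mul_re_add_im_mul_im (a h : ℂ) : a.re * h.re + a.im * h.im = (conj a * h).re := by
  simp [Complex.mul_re, Complex.conj_re, Complex.conj_im]

/-- `‖a‖² = (Re a)² + (Im a)²`. [folklore] -/
private theorem norm_sq_eq_re_sq_add_im_sq (a : ℂ) : ‖a‖ ^ 2 = a.re ^ 2 + a.im ^ 2 := by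
  rw [Complex.sq_norm, Complex.normSq_apply]
  ring

/-- `∫ ‖f‖ ≤ C` from `‖f‖_{L²} ≤ C` on the probability space `T^d`. [folklore] -/
private theorem integral_norm_le_of_eLpNorm_two_le {f : UnitAddTorus d → EuclideanSpace ℝ d}
    (hf : MemLp f 2 volume) {C : ℝ≥0} (h : eLpNorm f 2 volume ≤ C) : ∫ x, ‖f x‖ ≤ C := by
  have h1 : ENNReal.ofReal (∫ x, ‖f x‖) = eLpNorm f 1 volume := by
    rw [eLpNorm_one_eq_lintegral_enorm, ← ofReal_integral_norm_eq_lintegral_enorm (hf.integrable one_le_two)]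
  have h2 : ENNReal.ofReal (∫ x, ‖f x‖) ≤ C :=
    h1.le.trans ((eLpNorm_le_eLpNorm_of_exponent_le (by norm_num) hf.1).trans h)
  have := (ENNReal.ofReal_le_iff_le_toReal ENNReal.coe_ne_top).1 h2
  simpa using this

/-- `‖𝓕(complexify ∘ f)(k)‖ ≤ ∫ ‖f‖` for integrable `f`. [folklore] -/
private theorem norm_mFourierCoeff_complexify_le' {f : UnitAddTorus d → EuclideanSpace ℝ d}
    (hf : Integrable f volume) (k : d → ℤ) :
    ‖mFourierCoeff (FunctionSpaces.EuclideanSpace.complexify ∘ f) k‖ ≤ ∫ x, ‖f x‖ := by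
  rw [FunctionSpaces.Torus.mFourierCoeff_eq_integral_volume]
  have hint : Integrable (fun x => mFourier (-k) x • (FunctionSpaces.EuclideanSpace.complexify ∘ f) x) volume :=
    FunctionSpaces.Torus.integrable_mFourier_smul' (FunctionSpaces.Torus.integrable_complexify_comp hf) k
  refine (norm_integral_le_integral_norm _).trans (integral_mono hint.norm hf.norm fun x => ?_)
  dsimp only
  rw [norm_smul, Function.comp_apply, FunctionSpaces.EuclideanSpace.norm_complexify]
  exact mul_le_of_le_one_left (norm_nonneg _) (((mFourier (-k)).norm_coe_le_norm x).trans_eq mFourier_norm)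

end Scalar

/-! ## The energy identity of one mode -/

section ModeEnergy

variable [DecidableEq d]

namespace IsWeakPassiveVectorOn

variable {A T ν : ℝ} {b w : ℝ → UnitAddTorus d → EuclideanSpace ℝ d} {w₀ : UnitAddTorus d → EuclideanSpace ℝ d}

/-- Integrability on `(0,T)` of the right-hand side `Φ_G = ∫⟪w, (b·∇)G + νΔG⟫ + A ∫⟪b, (w·∇)G⟫` of
the steady-test identity, for a smooth steady field `G`. [cite: DiPernaLions1989, §II.1 (12)–(14)] -/
theorem integrableOn_steadyRHS (h : IsWeakPassiveVectorOn A T ν b w₀ w)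
    {G : UnitAddTorus d → EuclideanSpace ℝ d} (hG : FunctionSpaces.Torus.IsSmooth G) :
    IntegrableOn (fun τ =>
      (∫ x, ⟪w τ x, FunctionSpaces.Torus.convect (b τ) G x + ν • FunctionSpaces.Torus.laplacian G x⟫_ℝ) +
        A * ∫ x, ⟪b τ x, FunctionSpaces.Torus.convect (w τ) G x⟫_ℝ) (Ioo 0 T) volume := by
  have hG1 : FunctionSpaces.Torus.IsContDiff 1 G := hG.isContDiff (by simp)
  have hGd : ∀ j, Continuous (uncurry fun (_ : ℝ) (x : UnitAddTorus d) => FunctionSpaces.Torus.partialDeriv j G x) :=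
    fun j => (hG.partialDeriv j).continuous.comp continuous_snd
  have hGl : Continuous (uncurry fun (_ : ℝ) (x : UnitAddTorus d) => FunctionSpaces.Torus.laplacian G x) :=
    hG.laplacian.continuous.comp continuous_snd
  have hI₂ : Integrable (fun p : ℝ × UnitAddTorus d =>
      ⟪w p.1 p.2, FunctionSpaces.Torus.convect (b p.1) G p.2 + ν • FunctionSpaces.Torus.laplacian G p.2⟫_ℝ)
      (((volume : Measure ℝ).restrict (Ioo 0 T)).prod volume) := by
    have e : (fun p : ℝ × UnitAddTorus d =>
        ⟪w p.1 p.2, FunctionSpaces.Torus.convect (b p.1) G p.2 + ν • FunctionSpaces.Torus.laplacian G p.2⟫_ℝ) =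
        fun p => ⟪w p.1 p.2, FunctionSpaces.Torus.convect (b p.1) ((fun (_ : ℝ) x => G x) p.1) p.2⟫_ℝ +
          ν * ⟪w p.1 p.2, (fun (_ : ℝ) x => FunctionSpaces.Torus.laplacian G x) p.1 p.2⟫_ℝ := by
      funext p
      rw [inner_add_right, real_inner_smul_right]
    rw [e]
    exact (h.integrable_inner_convect (fun _ => hG1) hGd).add ((h.integrable_inner_of_continuous hGl).const_mul ν)
  have hI₃ : Integrable (fun p : ℝ × UnitAddTorus d => A * ⟪b p.1 p.2, FunctionSpaces.Torus.convect (w p.1) G p.2⟫_ℝ)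
      (((volume : Measure ℝ).restrict (Ioo 0 T)).prod volume) :=
    (h.integrable_inner_carrier_convect (Φ := fun _ => G) (fun _ => hG1) hGd).const_mul A
  refine (hI₂.integral_prod_left.add hI₃.integral_prod_left).congr (Eventually.of_forall fun t => ?_)
  simp only [Pi.add_apply]
  rw [integral_const_mul]

/-- The pairing with a continuous steady field is essentially bounded on `(0,T)`:
`|∫⟪w(τ), G⟫| ≤ K` for a.e. `τ` (`w ∈ L^∞_t L²_x ⊂ L^∞_t L¹_x`). [cite: DiPernaLions1989, §II.1 (12)–(14)] -/
theorem exists_ae_abs_integral_inner_le (h : IsWeakPassiveVectorOn A T ν b w₀ w)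
    {G : UnitAddTorus d → EuclideanSpace ℝ d} (hG : Continuous G) :
    ∃ K : ℝ, ∀ᵐ τ ∂(volume.restrict (Ioo 0 T)), |∫ x, ⟪w τ x, G x⟫_ℝ| ≤ K := by
  obtain ⟨M, hM⟩ := (isCompact_univ.image hG).isBounded.exists_norm_le
  have hM' : ∀ x, ‖G x‖ ≤ M := fun x => hM _ ⟨x, mem_univ _, rfl⟩
  obtain ⟨C₁, hC₁⟩ := h.exists_eLpNorm_le
  have h0 : 0 ≤ M := (norm_nonneg _).trans (hM' 0)
  refine ⟨M * C₁, ?_⟩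
  filter_upwards [hC₁, h.ae_memLp_two] with τ hτ hm
  have hI : Integrable (w τ) volume := hm.integrable one_le_two
  calc |∫ x, ⟪w τ x, G x⟫_ℝ| ≤ ∫ x, M * ‖w τ x‖ := by
        rw [← Real.norm_eq_abs]
        refine norm_integral_le_of_norm_le (hI.norm.const_mul M) (Eventually.of_forall fun x => ?_)
        rw [mul_comm]
        exact (norm_inner_le_norm _ _).trans (mul_le_mul_of_nonneg_left (hM' x) (norm_nonneg _))
    _ = M * ∫ x, ‖w τ x‖ := integral_const_mul _ _
    _ ≤ M * C₁ := mul_le_mul_of_nonneg_left (integral_norm_le_of_eLpNorm_two_le hm hτ) h0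

/-- **Per-mode energy identity, physical-space form.** For a smooth divergence-free steady field
`G` and a.e. `t ∈ (0,T)`:
`(∫⟪w(t), G⟫)² = (∫⟪w₀, G⟫)² + 2 ∫_{(0,t]} Φ_G(τ) (∫⟪w(τ), G⟫) dτ`,
`Φ_G(τ) = ∫⟪w(τ), (b(τ)·∇)G + νΔG⟫ + A ∫⟪b(τ), (w(τ)·∇)G⟫` (the Galerkin system tested against its own
solution, one mode at a time; Robinson–Rodrigo–Sadowski 2016, §4.2).
[cite: RobinsonRodrigoSadowski2016, §4.2 (Galerkin energy estimate)] -/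
theorem ae_mode_energy_eq (h : IsWeakPassiveVectorOn A T ν b w₀ w)
    {G : UnitAddTorus d → EuclideanSpace ℝ d} (hG : FunctionSpaces.Torus.IsSmooth G)
    (hGdiv : FunctionSpaces.Torus.IsDivFree G) :
    ∀ᵐ t ∂(volume.restrict (Ioo 0 T)),
      (∫ x, ⟪w t x, G x⟫_ℝ) ^ 2 = (∫ x, ⟪w₀ x, G x⟫_ℝ) ^ 2 +
        2 * ∫ τ in Ioc 0 t,
          ((∫ x, ⟪w τ x, FunctionSpaces.Torus.convect (b τ) G x + ν • FunctionSpaces.Torus.laplacian G x⟫_ℝ) +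
            A * ∫ x, ⟪b τ x, FunctionSpaces.Torus.convect (w τ) G x⟫_ℝ) * ∫ x, ⟪w τ x, G x⟫_ℝ :=
  ae_sq_eq_of_ae_eq_add_setIntegral' (h.integrableOn_steadyRHS hG) (h.ae_integral_inner_eq hG hGdiv)

/-- The mode pairings are essentially bounded: `|⟪ŵ(τ)(k), z⟫| ≤ K` for a.e. `τ ∈ (0,T)`
(`‖ŵ(τ)(k)‖ ≤ ‖w(τ)‖_{L¹} ≤ ‖w(τ)‖_{L²}`). [cite: DiPernaLions1989, §II.1 (12)–(14)] -/
theorem exists_ae_norm_inner_mFourierCoeff_le (h : IsWeakPassiveVectorOn A T ν b w₀ w) (k : d → ℤ)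
    (z : EuclideanSpace ℂ d) :
    ∃ K : ℝ, ∀ᵐ τ ∂(volume.restrict (Ioo 0 T)),
      ‖⟪mFourierCoeff (FunctionSpaces.EuclideanSpace.complexify ∘ w τ) k, z⟫_ℂ‖ ≤ K := by
  obtain ⟨C₁, hC₁⟩ := h.exists_eLpNorm_le
  refine ⟨C₁ * ‖z‖, ?_⟩
  filter_upwards [hC₁, h.ae_memLp_two] with τ hτ hm
  calc ‖⟪mFourierCoeff (FunctionSpaces.EuclideanSpace.complexify ∘ w τ) k, z⟫_ℂ‖
      ≤ ‖mFourierCoeff (FunctionSpaces.EuclideanSpace.complexify ∘ w τ) k‖ * ‖z‖ := norm_inner_le_norm _ _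
    _ ≤ C₁ * ‖z‖ := mul_le_mul_of_nonneg_right
        ((norm_mFourierCoeff_complexify_le' (hm.integrable one_le_two) k).trans
          (integral_norm_le_of_eLpNorm_two_le hm hτ)) (norm_nonneg _)

/-- Integrability on `(0,T)` of `conj α · H` for the mode pairing `α(τ) = ⟪ŵ(τ)(k), z⟫` (essentially
bounded) and any `H ∈ L¹(0,T)`. [cite: DiPernaLions1989, §II.1 (12)–(14)] -/
theorem integrableOn_conj_inner_mul (h : IsWeakPassiveVectorOn A T ν b w₀ w) (k : d → ℤ)
    (z : EuclideanSpace ℂ d) {H : ℝ → ℂ} (hH : IntegrableOn H (Ioo 0 T) volume) :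
    IntegrableOn (fun τ => conj ⟪mFourierCoeff (FunctionSpaces.EuclideanSpace.complexify ∘ w τ) k, z⟫_ℂ * H τ)
      (Ioo 0 T) volume := by
  obtain ⟨K, hK⟩ := h.exists_ae_norm_inner_mFourierCoeff_le k z
  have hαm : AEStronglyMeasurable
      (fun τ => conj ⟪mFourierCoeff (FunctionSpaces.EuclideanSpace.complexify ∘ w τ) k, z⟫_ℂ)
      (volume.restrict (Ioo 0 T)) :=
    (continuous_conj.comp_aestronglyMeasurable ((h.integrableOn_mFourierCoeff k).inner_const z).aestronglyMeasurable)
  refine Integrable.bdd_mul (c := K) hH hαm ?_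
  filter_upwards [hK] with τ hτ
  rwa [Complex.norm_conj]

/-- **Per-mode energy identity in Fourier variables.** For a frequency `k`, a transversal vector
`z ∈ ℂ^d` (`k · z = 0`) and a.e. `t ∈ (0,T)`, with `α(t) = ⟪ŵ(t)(k), z⟫_ℂ`, `νₖ = 4π²ν|k|²` and
`β(τ) = ∑ⱼ 2πikⱼ ⟪𝓕(bⱼ w)(τ)(k), z⟫ + A ∑ⱼ 2πikⱼ ⟪𝓕(wⱼ b)(τ)(k), z⟫`:
`|α(t)|² = |⟪ŵ₀(k), z⟫|² + 2 ∫_{(0,t]} (-νₖ |α(τ)|² + Re (conj α(τ) · β(τ))) dτ`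
(real and imaginary parts of `PassiveVectorFourier.ae_inner_mFourierCoeff_eq`, squared by the product
rule for a.e. primitives and added). [cite: RobinsonRodrigoSadowski2016, §4.2 (Galerkin energy estimate)] -/
theorem ae_sq_norm_inner_mFourierCoeff_eq (h : IsWeakPassiveVectorOn A T ν b w₀ w)
    (hw₀ : Integrable w₀ volume) (k : d → ℤ) {z : EuclideanSpace ℂ d}
    (hz : ∑ j, (k j : ℂ) * z j = 0) :
    ∀ᵐ t ∂(volume.restrict (Ioo 0 T)),
      ‖⟪mFourierCoeff (FunctionSpaces.EuclideanSpace.complexify ∘ w t) k, z⟫_ℂ‖ ^ 2 =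
        ‖⟪mFourierCoeff (FunctionSpaces.EuclideanSpace.complexify ∘ w₀) k, z⟫_ℂ‖ ^ 2 +
        2 * ∫ τ in Ioc 0 t,
          (-(4 * Real.pi ^ 2 * ν * FunctionSpaces.Torus.freqNormSq k) *
              ‖⟪mFourierCoeff (FunctionSpaces.EuclideanSpace.complexify ∘ w τ) k, z⟫_ℂ‖ ^ 2 +
            (conj ⟪mFourierCoeff (FunctionSpaces.EuclideanSpace.complexify ∘ w τ) k, z⟫_ℂ *
              ((∑ j, (2 * Real.pi * I * (k j)) *
                  ⟪mFourierCoeff (FunctionSpaces.EuclideanSpace.complexify ∘ fun x => b τ x j • w τ x) k, z⟫_ℂ) +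
                (A : ℂ) * ∑ j, (2 * Real.pi * I * (k j)) *
                  ⟪mFourierCoeff (FunctionSpaces.EuclideanSpace.complexify ∘ fun x => w τ x j • b τ x) k, z⟫_ℂ)).re) := by
  -- names
  set ν' : ℝ := 4 * Real.pi ^ 2 * ν * FunctionSpaces.Torus.freqNormSq k with hν'
  set α : ℝ → ℂ := fun t => ⟪mFourierCoeff (FunctionSpaces.EuclideanSpace.complexify ∘ w t) k, z⟫_ℂ with hα
  set α₀ : ℂ := ⟪mFourierCoeff (FunctionSpaces.EuclideanSpace.complexify ∘ w₀) k, z⟫_ℂ with hα₀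
  set β : ℝ → ℂ := fun τ => (∑ j, (2 * Real.pi * I * (k j)) *
      ⟪mFourierCoeff (FunctionSpaces.EuclideanSpace.complexify ∘ fun x => b τ x j • w τ x) k, z⟫_ℂ) +
    (A : ℂ) * ∑ j, (2 * Real.pi * I * (k j)) *
      ⟪mFourierCoeff (FunctionSpaces.EuclideanSpace.complexify ∘ fun x => w τ x j • b τ x) k, z⟫_ℂ with hβ
  set H : ℝ → ℂ := fun τ => (-((ν' : ℝ) : ℂ)) * α τ + β τ with hH
  have hHi : IntegrableOn H (Ioo 0 T) volume := h.integrableOn_modeRHS k z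
  -- the modewise identity and its real and imaginary parts
  have hid : ∀ᵐ t ∂(volume.restrict (Ioo 0 T)), α t = α₀ + ∫ τ in Ioc 0 t, H τ :=
    h.ae_inner_mFourierCoeff_eq hw₀ k hz
  have hre : ∀ᵐ t ∂(volume.restrict (Ioo 0 T)), (α t).re = α₀.re + ∫ τ in Ioc 0 t, (H τ).re := by
    filter_upwards [hid, ae_restrict_mem measurableSet_Ioo] with t ht htT
    rw [ht, Complex.add_re, re_integral_eq (hHi.mono_set (Ioc_subset_Ioo_right htT.2))]
  have him : ∀ᵐ t ∂(volume.restrict (Ioo 0 T)), (α t).im = α₀.im + ∫ τ in Ioc 0 t, (H τ).im := by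
    filter_upwards [hid, ae_restrict_mem measurableSet_Ioo] with t ht htT
    rw [ht, Complex.add_im, im_integral_eq (hHi.mono_set (Ioc_subset_Ioo_right htT.2))]
  have h1 := ae_sq_eq_of_ae_eq_add_setIntegral' hHi.re hre
  have h2 := ae_sq_eq_of_ae_eq_add_setIntegral' hHi.im him
  -- integrability of the products on `(0,T)`
  have hP : IntegrableOn (fun τ => conj (α τ) * H τ) (Ioo 0 T) volume := h.integrableOn_conj_inner_mul k z hHi
  have hαi : IntegrableOn α (Ioo 0 T) volume := (h.integrableOn_mFourierCoeff k).inner_const z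
  obtain ⟨K, hK⟩ := h.exists_ae_norm_inner_mFourierCoeff_le k z
  have hP1 : IntegrableOn (fun τ => (H τ).re * (α τ).re) (Ioo 0 T) volume := by
    have hαm : AEStronglyMeasurable (fun τ => (α τ).re) (volume.restrict (Ioo 0 T)) :=
      Complex.continuous_re.comp_aestronglyMeasurable hαi.aestronglyMeasurable
    refine Integrable.mul_bdd (c := K) hHi.re hαm ?_
    filter_upwards [hK] with τ hτ
    rw [Real.norm_eq_abs]
    exact (Complex.abs_re_le_norm _).trans hτ
  have hP2 : IntegrableOn (fun τ => (H τ).im * (α τ).im) (Ioo 0 T) volume := by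
    have hαm : AEStronglyMeasurable (fun τ => (α τ).im) (volume.restrict (Ioo 0 T)) :=
      Complex.continuous_im.comp_aestronglyMeasurable hαi.aestronglyMeasurable
    refine Integrable.mul_bdd (c := K) hHi.im hαm ?_
    filter_upwards [hK] with τ hτ
    rw [Real.norm_eq_abs]
    exact (Complex.abs_im_le_norm _).trans hτ
  filter_upwards [h1, h2, ae_restrict_mem measurableSet_Ioo] with t ht1 ht2 htT
  simp only [RCLike.re_to_complex, RCLike.im_to_complex] at ht1 ht2
  have hsub : Ioc 0 t ⊆ Ioo 0 T := Ioc_subset_Ioo_right htT.2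
  -- assemble `|α|² = re² + im²`
  rw [norm_sq_eq_re_sq_add_im_sq, norm_sq_eq_re_sq_add_im_sq α₀]
  rw [show (⟪mFourierCoeff (FunctionSpaces.EuclideanSpace.complexify ∘ w t) k, z⟫_ℂ) = α t from rfl, ht1, ht2,
    add_add_add_comm, ← mul_add, ← integral_add (hP1.mono_set hsub) (hP2.mono_set hsub)]
  -- pointwise: `Re H Re α + Im H Im α = Re (conj α · H) = -ν' |α|² + Re (conj α · β)`
  have e2 : ∀ τ, (H τ).re * (α τ).re + (H τ).im * (α τ).im = -ν' * ‖α τ‖ ^ 2 + (conj (α τ) * β τ).re := by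
    intro τ
    have e1 : (H τ).re * (α τ).re + (H τ).im * (α τ).im = (conj (α τ) * H τ).re := by
      rw [← re_mul_re_add_im_mul_im]
      ring
    rw [e1, hH]
    simp only
    rw [mul_add, Complex.add_re]
    congr 1
    rw [← mul_assoc, mul_comm (conj (α τ)) _, mul_assoc, Complex.conj_mul', ← Complex.ofReal_pow,
      ← Complex.ofReal_neg, ← Complex.ofReal_mul, Complex.ofReal_re]
  congr 2
  refine integral_congr_ae (ae_of_all _ fun τ => ?_)
  exact e2 τ

end IsWeakPassiveVectorOn

end ModeEnergy

end Torus

end Literature.Analysis.FluidPDE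

end
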